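import Mathlib
import Summits.Ventures.PercRepro2.TypedStarGen

/-!
# ONE UNMARKED STAR VERTEX OF ANY DEGREE OVER AN ALL-MARKED BASE, II: THE TRANSFER (blind cell
PercRepro2, p2 g2, 2026-08-25; sub-claim S1 (C), the degree-`d` form)

* `splitSum` / **`typedCount_split_list`** — the typed count split over a list of typed edges
  (the iterated `typedCount_split`);
* `placeSum` — the `K₅`-side placement sum: for a list of (neighbour, type) the nested sum over the
  placements, accumulating the open neighbours per copy, ending in the masked count `mcount` at the
  clique masks (`3^d` placements);
* **`typedCount_K3_patch`** — the typed `K₃` base of the star graph equals `placeSum` at the pattern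
  minor; **`StarNonnegGen`** — row 2′TRI on `K₅ + u` of degree `d` (the statement typer-1 certifies;
  mine-1's §24(i) integer-weighted groups are its splits); **`typedCount_K3_nonneg_of_gen`**.

Own code; standard axioms; no certificate here.
-/

namespace Summit.Ventures.PercRepro2

open Hub

namespace K5

/-! ## Splitting a list of typed edges off -/

section Split

variable {E : Type*} [Fintype E] [DecidableEq E] {R : Type*} [CommRing R]

/-- The nested placement sum over a list of typed edges: `G` receives the three star-state
configurations. -/
noncomputable def splitSum (τ : E → ℕ) : List E → (Config E → Config E → Config E → R) → R
  | [], G => G (fun _ => false) (fun _ => false) (fun _ => false)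
  | e :: L, G => ∑ a : Bool, ∑ b : Bool, ∑ c : Bool,
      if a.toNat + b.toNat + c.toNat = τ e then
        splitSum τ L (fun a' b' c' => G (Function.update a' e a) (Function.update b' e b)
          (Function.update c' e c))
      else 0

omit [Fintype E] in
/-- The typed set with the list removed. -/
lemma filter_erase_eq (F : Finset E) (e : E) (L : List E) :
    (F.erase e).filter (fun e' => e' ∉ L) = F.filter fun e' => e' ∉ e :: L := by
  ext e'
  simp only [Finset.mem_filter, Finset.mem_erase, List.mem_cons, not_or]
  tauto

omit [Fintype E] in
/-- The pinning with the list closed. -/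
lemma update_closed_eq (z : Config E) (e : E) (L : List E) :
    (fun e' => if e' ∈ L then false else Function.update z e false e') =
      fun e' => if e' ∈ e :: L then false else z e' := by
  funext e'
  by_cases h : e' = e
  · subst h; simp
  · by_cases hL : e' ∈ L
    · simp [hL]
    · have : e' ∉ e :: L := by simp [h, hL]
      simp [hL, this, Function.update_of_ne h]

/-- **The typed count split over a list of typed edges** (the iterated `typedCount_split`). -/
theorem typedCount_split_list (L : List E) (hnd : L.Nodup) :
    ∀ (F : Finset E), (∀ e ∈ L, e ∈ F) → ∀ (z : Config E) (τ : E → ℕ)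
      (K : Config E → Config E → Config E → R),
    typedCount F z τ K =
      splitSum τ L (fun a b c =>
        typedCount (F.filter fun e => e ∉ L) (fun e => if e ∈ L then false else z e) τ
          (fun x y w => K (patch L a x) (patch L b y) (patch L c w))) := by
  induction L with
  | nil =>
    intro F _ z τ K
    have hF : F.filter (fun e => e ∉ ([] : List E)) = F :=
      Finset.filter_true_of_mem fun _ _ => List.not_mem_nil
    have hz : (fun e => if e ∈ ([] : List E) then false else z e) = z := by
      funext e; simp
    have hK : ∀ a x : Config E, patch ([] : List E) a x = x := by
      intro a x; funext e; simp [patch]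
    simp only [splitSum, hF, hz, hK]
  | cons e L ih =>
    intro F hF z τ K
    have heL : e ∉ L := (List.nodup_cons.1 hnd).1
    rw [CovForm.TypedRed.typedCount_split F e (hF e List.mem_cons_self)]
    simp only [splitSum]
    refine Finset.sum_congr rfl fun a _ => Finset.sum_congr rfl fun b _ =>
      Finset.sum_congr rfl fun c _ => ?_
    by_cases hA : a.toNat + b.toNat + c.toNat = τ e
    · rw [if_pos hA, if_pos hA]
      rw [ih (List.nodup_cons.1 hnd).2 (F.erase e)
        (fun e' he' => Finset.mem_erase.2 ⟨fun h => heL (by rw [← h]; exact he'),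
          hF e' (List.mem_cons_of_mem _ he')⟩)]
      congr 1
      funext a' b' c'
      rw [filter_erase_eq, update_closed_eq]
      congr 1
      funext x y w
      rw [patch_cons e L a' x a heL, patch_cons e L b' y b heL, patch_cons e L c' w c heL]
    · rw [if_neg hA, if_neg hA]

end Split

/-! ## The `K₅`-side placement sum -/

section Place

variable {R : Type*} [Field R]

/-- The `K₅`-side placement sum over a list of (neighbour, type): the nested sum over the placements
of the star edges, accumulating the open neighbours per copy, ending in the masked count at the
clique masks. -/
noncomputable def placeSum (F : Finset (Fin 10)) (z : Config (Fin 10)) (τ : Fin 10 → ℕ)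
    (K : Config (Fin 10) → Config (Fin 10) → Config (Fin 10) → R) :
    List (Fin 5 × ℕ) → Finset (Fin 5) → Finset (Fin 5) → Finset (Fin 5) → R
  | [], s₁, s₂, s₃ => mcount F z τ (cliqueMask s₁) (cliqueMask s₂) (cliqueMask s₃) K
  | (p, t) :: L, s₁, s₂, s₃ => ∑ a : Bool, ∑ b : Bool, ∑ c : Bool,
      if a.toNat + b.toNat + c.toNat = t then
        placeSum F z τ K L (if a then insert p s₁ else s₁) (if b then insert p s₂ else s₂)
          (if c then insert p s₃ else s₃)
      else 0

end Place

/-! ## The transfer -/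

section Transfer

variable {V : Type*} {E : Type*} [Fintype E] [DecidableEq E]
variable {R : Type*} [Field R]

omit [Fintype E] in
/-- The open-neighbour set of a star state supported on `L`, one more edge. -/
lemma imgOpen_cons (m : V → Fin 5) (nbr : E → V) (e : E) (L : List E) (he : e ∉ L) (a : Config E)
    (s : Bool) :
    imgOpen m nbr (e :: L) (Function.update a e s) =
      (if s then insert (m (nbr e)) (imgOpen m nbr L a) else imgOpen m nbr L a) := by
  ext p
  rw [mem_imgOpen]
  cases s
  · simp only [Bool.false_eq_true, if_false, mem_imgOpen]
    constructor
    · rintro ⟨e', he', ha, hp⟩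
      rcases List.mem_cons.1 he' with rfl | he'
      · simp at ha
      · refine ⟨e', he', ?_, hp⟩
        rwa [Function.update_of_ne (fun h => he (by rw [← h]; exact he'))] at ha
    · rintro ⟨e', he', ha, hp⟩
      refine ⟨e', List.mem_cons_of_mem _ he', ?_, hp⟩
      rwa [Function.update_of_ne (fun h => he (by rw [← h]; exact he'))]
  · simp only [if_true, Finset.mem_insert, mem_imgOpen]
    constructor
    · rintro ⟨e', he', ha, hp⟩
      rcases List.mem_cons.1 he' with rfl | he'
      · exact Or.inl hp.symm
      · refine Or.inr ⟨e', he', ?_, hp⟩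
        rwa [Function.update_of_ne (fun h => he (by rw [← h]; exact he'))] at ha
    · rintro (hp | ⟨e', he', ha, hp⟩)
      · exact ⟨e, List.mem_cons_self, by simp, hp.symm⟩
      · refine ⟨e', List.mem_cons_of_mem _ he', ?_, hp⟩
        rwa [Function.update_of_ne (fun h => he (by rw [← h]; exact he'))]

omit [Fintype E] in
/-- The `G`-side split sum with the masked `K₅` kernel is the `K₅`-side placement sum, with the
accumulated neighbour sets. -/
lemma splitSum_eq_placeSum (m : V → Fin 5) (nbr : E → V) (F' : Finset (Fin 10)) (z' : Config (Fin 10))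
    (τ' : Fin 10 → ℕ) (K : Config (Fin 10) → Config (Fin 10) → Config (Fin 10) → R) (τ : E → ℕ) :
    ∀ (L : List E), L.Nodup → ∀ (s₁ s₂ s₃ : Finset (Fin 5)),
      splitSum τ L (fun a b c =>
        typedCount F' z' τ' fun x y w =>
          K (orOn (cliqueMask (s₁ ∪ imgOpen m nbr L a)) x) (orOn (cliqueMask (s₂ ∪ imgOpen m nbr L b)) y)
            (orOn (cliqueMask (s₃ ∪ imgOpen m nbr L c)) w)) =
      placeSum F' z' τ' K (L.map fun e => (m (nbr e), τ e)) s₁ s₂ s₃ := by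
  intro L
  induction L with
  | nil =>
    intro _ s₁ s₂ s₃
    simp [splitSum, placeSum, mcount, imgOpen]
  | cons e L ih =>
    intro hnd s₁ s₂ s₃
    have heL : e ∉ L := (List.nodup_cons.1 hnd).1
    simp only [splitSum, List.map_cons, placeSum]
    refine Finset.sum_congr rfl fun a _ => Finset.sum_congr rfl fun b _ =>
      Finset.sum_congr rfl fun c _ => ?_
    by_cases hA : a.toNat + b.toNat + c.toNat = τ e
    · rw [if_pos hA, if_pos hA, ← ih (List.nodup_cons.1 hnd).2]
      congr 1
      funext a' b' c'
      simp only [imgOpen_cons m nbr e L heL]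
      cases a <;> cases b <;> cases c <;> simp [Finset.insert_union]
    · rw [if_neg hA, if_neg hA]

omit [Fintype E] in
/-- The pinning with the star closed is `z ≡ false`. -/
lemma closed_list_false (L : List E) :
    (fun e => if e ∈ L then false else (fun _ : E => false) e) = fun _ => false := by
  funext e; simp

/-- **THE TYPED `K₃` BASE OF A GRAPH WITH ONE UNMARKED STAR VERTEX OF ANY DEGREE OVER AN ALL-MARKED
BASE IS THE `K₅`-SIDE PLACEMENT SUM** at the pattern minor of the all-marked part, the list of
(neighbour, type) of the star edges and empty starting sets. -/
theorem typedCount_K3_patch (m : V → Fin 5) (ends : E → Sym2 V) (F : Finset E) {M : Set V}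
    (hinj : Set.InjOn m M) {u : V} {nbr : E → V} {L : List E} (hs : StarL ends M u nbr L)
    (hL : ∀ e ∈ L, e ∈ F)
    (hM : ∀ e ∈ F.filter (fun e => e ∉ L), ∀ v ∈ ends e, v ∈ M)
    (hloop : ∀ e ∈ F.filter (fun e => e ∉ L), ¬ (ends e).IsDiag)
    (hpar : ∀ e ∈ F.filter (fun e => e ∉ L), ∀ e' ∈ F.filter (fun e => e ∉ L), ends e = ends e' → e = e')
    {o a₁ a₂ a₃ b : V} (ho : o ∈ M) (ha₁ : a₁ ∈ M) (ha₂ : a₂ ∈ M) (ha₃ : a₃ ∈ M) (hb : b ∈ M)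
    (τ : E → ℕ) :
    typedCount F (fun _ => false) τ (CovForm.K3 (R := R) ends o a₁ a₂ a₃ b) =
      placeSum (minorFM m ends (F.filter fun e => e ∉ L)) (fun _ => false)
        (minorτM m ends (F.filter fun e => e ∉ L) τ)
        (CovForm.K3 (R := R) ends5 (m o) (m a₁) (m a₂) (m a₃) (m b))
        (L.map fun e => (m (nbr e), τ e)) ∅ ∅ ∅ := by
  set F₀ := F.filter (fun e => e ∉ L) with hF₀
  rw [typedCount_split_list L hs.nodup F hL, closed_list_false, ← splitSum_eq_placeSum m nbr _ _ _ _ τ L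
    hs.nodup ∅ ∅ ∅]
  congr 1
  funext a b' c
  simp only [Finset.empty_union]
  rw [← typedCount_patternM_eq m ends F₀ hinj hM hloop hpar]
  exact typedCount_congr_closedOff F₀ τ _ _ fun x y w hx hy hw =>
    K3_patch hinj hM hloop hs ho ha₁ ha₂ ha₃ hb hx hy hw a b' c

end Transfer

/-! ## The `K₅` statement of any degree and its consequence -/

section Statement

variable (R : Type*) [Field R] [LinearOrder R]

/-- **Row 2′TRI on `K₅ + u` of any degree** (the statement typer-1 certifies, `3^d` placements): for
the marks `o, …, b ∈ Fin 5` and the star `L` = the list of (neighbour, type), the placement sum is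
nonnegative for every typed set of mark pairs and every type map. -/
def StarNonnegGen (o a₁ a₂ a₃ b : Fin 5) (L : List (Fin 5 × ℕ)) : Prop :=
  ∀ (F : Finset (Fin 10)) (τ : Fin 10 → ℕ),
    (∀ j ∈ F, ∀ v ∈ ends5 j, v = o ∨ v = a₁ ∨ v = a₂ ∨ v = a₃ ∨ v = b) →
    0 ≤ placeSum F (fun _ => false) τ (CovForm.K3 (R := R) ends5 o a₁ a₂ a₃ b) L ∅ ∅ ∅

variable {R}

/-- **Row 2′TRI on a typed graph with one unmarked star vertex of any degree over an all-marked base**,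
from the `K₅` statement at the image marking and star. -/
theorem typedCount_K3_nonneg_of_gen {V : Type*} {E : Type*} [Fintype E] [DecidableEq E]
    [DecidableEq V] (m : V → Fin 5) (ends : E → Sym2 V) (F : Finset E) {M : Set V}
    (hinj : Set.InjOn m M) {u : V} {nbr : E → V} {L : List E} (hs : StarL ends M u nbr L)
    (hL : ∀ e ∈ L, e ∈ F)
    (hM : ∀ e ∈ F.filter (fun e => e ∉ L), ∀ v ∈ ends e, v ∈ M)
    (hloop : ∀ e ∈ F.filter (fun e => e ∉ L), ¬ (ends e).IsDiag)
    (hpar : ∀ e ∈ F.filter (fun e => e ∉ L), ∀ e' ∈ F.filter (fun e => e ∉ L), ends e = ends e' → e = e')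
    {o a₁ a₂ a₃ b : V} (ho : o ∈ M) (ha₁ : a₁ ∈ M) (ha₂ : a₂ ∈ M) (ha₃ : a₃ ∈ M) (hb : b ∈ M)
    (hMk : ∀ v ∈ M, v = o ∨ v = a₁ ∨ v = a₂ ∨ v = a₃ ∨ v = b) (τ : E → ℕ)
    (hS : StarNonnegGen R (m o) (m a₁) (m a₂) (m a₃) (m b) (L.map fun e => (m (nbr e), τ e))) :
    0 ≤ typedCount F (fun _ => false) τ (CovForm.K3 (R := R) ends o a₁ a₂ a₃ b) := by
  rw [typedCount_K3_patch m ends F hinj hs hL hM hloop hpar ho ha₁ ha₂ ha₃ hb τ]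
  refine hS _ _ fun j hj v hv => ?_
  obtain ⟨y, hy, rfl⟩ := minorFM_ends m ends _ hM hj v hv
  rcases hMk y hy with rfl | rfl | rfl | rfl | rfl
  · exact Or.inl rfl
  · exact Or.inr (Or.inl rfl)
  · exact Or.inr (Or.inr (Or.inl rfl))
  · exact Or.inr (Or.inr (Or.inr (Or.inl rfl)))
  · exact Or.inr (Or.inr (Or.inr (Or.inr rfl)))

end Statement

end K5

end Summit.Ventures.PercRepro2
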